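import Literature.Geometry.Kaehler.RiemannSurfacePrimitivePrymCyclicCovers
import Literature.Geometry.Kaehler.RiemannSurfaceChevalleyWeilPositivity
import HarnessLib

/-!
# The primitive Prym part of a cyclic cover is non-zero iff `g ≥ 1`, unless `g = γ = 1` and `G ≠ 1`; hence an
# automorphism of order `n` of a surface of genus `g ≥ 2` has a PRIMITIVE `n`-th root of unity as an eigenvalue
# on `𝓗¹(M)` (Kopeliovich–Zemel, Corollary 7.4, the case `Q = G`)

Layer `Literature/Geometry/Kaehler`, sequel of `RiemannSurfacePrimitivePrymCyclicCovers` (for an abelian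
`G ≤ Aut M`: the faithful part `⊕_{ker χ = 1} E_χ(𝓗¹(M))` is a complement of `Σ_{1 ≠ H ≤ G} 𝓗¹(M)^H`, the
cotangent space of the primitive Prym variety `P̃(M/(M/G))`; `dim = Σ_{ker χ = 1} dim E_χ`) and of
`RiemannSurfaceChevalleyWeilPositivity` (Corollary 7.4's third assertion for every cyclic quotient `Q = G/ker χ`:
`Σ_{ψ : ker ψ = ker χ} dim E_ψ > 0 ⟺ g(M/ker χ) ≥ 1 ∧ ¬(g(M/ker χ) = γ = 1 ∧ χ ≠ 1)`). Here the quotient is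
`Q = G` itself (`N = 1`, `Y_Q = M`), for a CYCLIC `G ≤ Aut M`. Source as printed (Y. Kopeliovich, S. Zemel,
Israel J. Math. 234 (2019), Corollary 7.4 and the remark after it, arXiv:1609.02296 pp. 32–33):

> **Corollary 7.4.** […] Moreover, the primitive Prym variety associated with the cyclic quotient `Q` is
> non-trivial wherever `g_{Y_Q} ≥ 1`, except when `g_{Y_Q} = g_S = 1` and `Q` is not trivial.
> […] The fact that in the cases not covered by the last assertion in Corollary 7.4 the primitive Prym variety
> `P̃(Y_Q/S)` is trivial is obvious: If `g_{Y_Q} = 0` then `J(Y_Q)` itself is trivial, and if `Y_Q` is a non-trivial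
> unbranched cover of `S` and both have genus 1 then `J(Y_Q)` is the image of `J(S)` there.

With `Q = G = ⟨T⟩` cyclic of order `n` and `g = g(M) ≥ 2` the exception cannot occur, so the faithful characters of
`G` occur in `𝓗¹(M)`: some `χ ∈ Ĝ` with `ker χ = 1` has `E_χ ≠ 0`, i.e. `T` has an eigenvalue `χ(T)` on `𝓗¹(M)`
which is a PRIMITIVE `n`-th root of unity (compare `RiemannSurfaceAutomorphismEigenvalueMultiplicities`: for
`g(M/⟨T⟩) ≥ 2` EVERY `n`-th root of unity is an eigenvalue; here only `g(M) ≥ 2` is assumed).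

## What is proved (no definitions, no named facts, no instances)

* `arithGenus_orbitSurface_map_eq_of_eq_bot` (`g(M/1) = g(M)` for the trivial subgroup pushed into `Aut M`),
  `char_eq_one_iff_eq_bot_of_ker_eq_bot` (a faithful `χ` is trivial iff `G = 1`),
  **`finrank_biSup_ker_eq_bot_oneFormRep_pos_iff`** (cyclic `G ≤ Aut M`:
  `0 < dim ⊕_{ker χ = 1} E_χ ⟺ g ≥ 1 ∧ ¬(g = 1 ∧ γ = 1 ∧ G ≠ 1)` — COROLLARY 7.4 for `Q = G`),
  `finrank_biSup_ker_eq_bot_oneFormRep_eq_zero_of_arithGenus_eq_one` (the exceptional case: an unramified cyclic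
  isogeny of genus-one surfaces has trivial primitive Prym part);
* for `g(M) ≥ 2` (where `Aut M` is finite, `finite_autGroup`): **`finrank_biSup_ker_eq_bot_oneFormRep_pos`**,
  **`exists_ker_eq_bot_iInf_eigenspace_ne_bot`** (some faithful character of a cyclic `G` occurs in `𝓗¹(M)`), and
  **`exists_isPrimitiveRoot_hasEigenvalue_oneFormRep`** (every `T ∈ Aut M` of order `n` has a primitive `n`-th root
  of unity among its eigenvalues on `𝓗¹(M)`).

## References

* Y. Kopeliovich, S. Zemel, *On spaces associated with invariant divisors on Galois covers of Riemann surfaces and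
  their applications*, Israel J. Math. 234 (2019), Corollary 7.4 (third assertion, its proof) and the remark
  following it (arXiv:1609.02296 pp. 32–33). [KopeliovichZemel2019]
* H. M. Farkas, I. Kra, *Riemann Surfaces*, GTM 71, 2nd ed. (1992), V.2.4–V.2.5. [FarkasKra1992]
-/

noncomputable section

open scoped Manifold ContDiff Topology
open Set Filter Function Complex MulAction Module

namespace Literature.Geometry.Kaehler

namespace RiemannSurface

section Faithful

variable {M : Type*} [TopologicalSpace M] [ChartedSpace ℂ M] [IsManifold 𝓘(ℂ, ℂ) ω M]
  [CompactSpace M] [T2Space M] [PreconnectedSpace M] [Nonempty M] [Finite (autGroup M)]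
  (G : Subgroup (autGroup M)) [Fintype ↥G]

open OrbitSurface

omit [Fintype ↥G] in
/-- **`g(M/1) = g(M)`**: the orbit surface of the trivial subgroup (pushed into `Aut M`) has the genus of `M`
(`π` is a bijective holomorphic map). [cite: KopeliovichZemel2019, Corollary 7.4 («Y_Q = X» for `Q = G`)]
[cite: FarkasKra1992, V.2.4] -/
theorem arithGenus_orbitSurface_map_eq_of_eq_bot {N : Subgroup ↥G} (hN : N = ⊥) [Fintype ↥(N.map G.subtype)] :
    arithGenus (OrbitSurface ↥(N.map G.subtype) M) = arithGenus M := by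
  symm
  refine arithGenus_eq_of_bijective (OrbitSurface.mdifferentiable_mk (H := ↥(N.map G.subtype)) (M := M))
    ⟨fun x y hxy ↦ ?_, OrbitSurface.mk_surjective⟩
  obtain ⟨g, rfl⟩ := OrbitSurface.mk_eq_mk_iff.1 hxy
  obtain ⟨n, hn, hgn⟩ := Subgroup.mem_map.1 g.2
  rw [hN, Subgroup.mem_bot] at hn
  subst hn
  have hg : ((g : autGroup M)) = 1 := by rw [← hgn, map_one]
  rw [Subgroup.smul_def, hg, one_smul]

omit [TopologicalSpace M] [ChartedSpace ℂ M] [IsManifold 𝓘(ℂ, ℂ) ω M] [CompactSpace M] [T2Space M]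
  [PreconnectedSpace M] [Nonempty M] [Finite (autGroup M)] [Fintype ↥G] in
/-- A faithful character is trivial iff the group is: for `ker χ = 1`, `χ = 1 ⟺ G = 1`.
[cite: KopeliovichZemel2019, Corollary 7.4 («Q is not trivial»)] -/
theorem char_eq_one_iff_eq_bot_of_ker_eq_bot {Γ : Type*} [Group Γ] {G : Subgroup Γ} [Finite ↥G] {χ : ↥G →* ℂˣ}
    (hχ : χ.ker = ⊥) : χ = 1 ↔ G = ⊥ := by
  rw [← MonoidHom.ker_eq_top_iff, hχ, ← Subgroup.card_eq_iff_eq_top, Subgroup.card_bot, eq_comm,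
    ← Subgroup.eq_bot_iff_card]

open Classical in
/-- **COROLLARY 7.4 (third assertion) for `Q = G`: for a CYCLIC `G ≤ Aut M`, the primitive Prym part
`⊕_{χ faithful} E_χ(𝓗¹(M))` is non-zero iff `g(M) ≥ 1`, except when `g(M) = g(M/G) = 1` and `G ≠ 1`.**
[cite: KopeliovichZemel2019, Corollary 7.4, remark after Corollary 7.4] -/
theorem finrank_biSup_ker_eq_bot_oneFormRep_pos_iff (hcyc : IsCyclic ↥G) :
    0 < finrank ℂ ↥(⨆ (χ : ↥G →* ℂˣ) (_ : χ.ker = ⊥),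
        ⨅ h : ↥G, Module.End.eigenspace (oneFormRep M (h : autGroup M)) (χ h : ℂ)) ↔
      1 ≤ arithGenus M ∧ ¬ (arithGenus M = 1 ∧ arithGenus (OrbitSurface G M) = 1 ∧ G ≠ ⊥) := by
  haveI : Fintype (↥G →* ℂˣ) := Fintype.ofFinite _
  haveI := hcyc
  haveI : IsCyclic (↥G ⧸ (⊥ : Subgroup ↥G)) :=
    isCyclic_of_surjective (QuotientGroup.mk' (⊥ : Subgroup ↥G)) (QuotientGroup.mk'_surjective _)
  obtain ⟨χ₀, hχ₀⟩ := exists_char_ker_eq_of_isCyclic_quotient (G := ↥G) ⊥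
  haveI : Fintype ↥(χ₀.ker.map G.subtype) := Fintype.ofFinite _
  have h := sum_filter_ker_eq_finrank_pos_iff G (M := M) χ₀
  have hF : (Finset.univ.filter fun ψ : ↥G →* ℂˣ ↦ ψ.ker = χ₀.ker) =
      Finset.univ.filter fun ψ : ↥G →* ℂˣ ↦ ψ.ker = ⊥ := by
    simp_rw [hχ₀]
  rw [hF, arithGenus_orbitSurface_map_eq_of_eq_bot G hχ₀, Ne, char_eq_one_iff_eq_bot_of_ker_eq_bot hχ₀] at h
  rw [finrank_biSup_ker_eq_bot_oneFormRep_eq_sum G]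
  exact h

open Classical in
/-- «If `Y_Q` is a non-trivial unbranched cover of `S` and both have genus 1 then `J(Y_Q)` is the image of
`J(S)`»: for a non-trivial cyclic `G ≤ Aut M` with `g(M) = g(M/G) = 1` the faithful characters do not occur in
`𝓗¹(M)`. [cite: KopeliovichZemel2019, remark after Corollary 7.4] -/
theorem finrank_biSup_ker_eq_bot_oneFormRep_eq_zero_of_arithGenus_eq_one (hcyc : IsCyclic ↥G)
    (hg : arithGenus M = 1) (hγ : arithGenus (OrbitSurface G M) = 1) (hG : G ≠ ⊥) :
    finrank ℂ ↥(⨆ (χ : ↥G →* ℂˣ) (_ : χ.ker = ⊥),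
        ⨅ h : ↥G, Module.End.eigenspace (oneFormRep M (h : autGroup M)) (χ h : ℂ)) = 0 := by
  have h := finrank_biSup_ker_eq_bot_oneFormRep_pos_iff G (M := M) hcyc
  by_contra hne
  exact ((h.1 (Nat.pos_of_ne_zero hne)).2 ⟨hg, hγ, hG⟩).elim

end Faithful

/-! ### Genus `g ≥ 2`: faithful characters occur, primitive roots of unity are eigenvalues -/

section TwoLe

variable {M : Type*} [TopologicalSpace M] [ChartedSpace ℂ M] [IsManifold 𝓘(ℂ, ℂ) ω M]
  [CompactSpace M] [T2Space M] [PreconnectedSpace M] [Nonempty M]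

open OrbitSurface

/-- **For `g(M) ≥ 2` and a cyclic `G ≤ Aut M` the primitive Prym part `⊕_{χ faithful} E_χ(𝓗¹(M))` is non-zero.**
[cite: KopeliovichZemel2019, Corollary 7.4] -/
theorem finrank_biSup_ker_eq_bot_oneFormRep_pos (hg : 2 ≤ arithGenus M) (G : Subgroup (autGroup M))
    [Fintype ↥G] (hcyc : IsCyclic ↥G) :
    0 < finrank ℂ ↥(⨆ (χ : ↥G →* ℂˣ) (_ : χ.ker = ⊥),
        ⨅ h : ↥G, Module.End.eigenspace (oneFormRep M (h : autGroup M)) (χ h : ℂ)) := by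
  haveI : Finite (autGroup M) := finite_autGroup hg
  exact (finrank_biSup_ker_eq_bot_oneFormRep_pos_iff G hcyc).2 ⟨by omega, fun h ↦ by omega⟩

/-- **For `g(M) ≥ 2`, some FAITHFUL character of a cyclic `G ≤ Aut M` occurs in `𝓗¹(M)`.**
[cite: KopeliovichZemel2019, Corollary 7.4] -/
theorem exists_ker_eq_bot_iInf_eigenspace_ne_bot (hg : 2 ≤ arithGenus M) (G : Subgroup (autGroup M))
    [Fintype ↥G] (hcyc : IsCyclic ↥G) :
    ∃ χ : ↥G →* ℂˣ, χ.ker = ⊥ ∧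
      (⨅ h : ↥G, Module.End.eigenspace (oneFormRep M (h : autGroup M)) (χ h : ℂ)) ≠ ⊥ := by
  have h := finrank_biSup_ker_eq_bot_oneFormRep_pos hg G hcyc
  by_contra hcon
  push Not at hcon
  have hbot : (⨆ (χ : ↥G →* ℂˣ) (_ : χ.ker = ⊥),
      ⨅ h : ↥G, Module.End.eigenspace (oneFormRep M (h : autGroup M)) (χ h : ℂ)) = ⊥ := by
    rw [eq_bot_iff]
    exact iSup₂_le fun χ hχ ↦ (hcon χ hχ).le
  rw [hbot, finrank_bot] at h
  exact lt_irrefl 0 h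

/-- **An automorphism `T` of order `n` of a compact Riemann surface of genus `g ≥ 2` has a PRIMITIVE `n`-th root of
unity as an eigenvalue on `𝓗¹(M)`** (a faithful character `χ` of `⟨T⟩` occurs in `𝓗¹(M)`, and
`E_χ ⊆ Eig(T, χ(T))` with `χ(T)` of order `n`). [cite: KopeliovichZemel2019, Corollary 7.4] [cite: FarkasKra1992, V.2.4–V.2.5] -/
theorem exists_isPrimitiveRoot_hasEigenvalue_oneFormRep (hg : 2 ≤ arithGenus M) (σ : autGroup M) :
    ∃ μ : ℂ, IsPrimitiveRoot μ (orderOf σ) ∧ Module.End.HasEigenvalue (oneFormRep M σ) μ := by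
  classical
  haveI : Finite (autGroup M) := finite_autGroup hg
  haveI : Fintype ↥(Subgroup.zpowers σ) := Fintype.ofFinite _
  obtain ⟨χ, hχ, hne⟩ :=
    exists_ker_eq_bot_iInf_eigenspace_ne_bot hg (Subgroup.zpowers σ) inferInstance
  set g₀ : ↥(Subgroup.zpowers σ) := ⟨σ, Subgroup.mem_zpowers σ⟩ with hg₀
  refine ⟨(χ g₀ : ℂ), ?_, ?_⟩
  · -- `χ(T)` has order `n = orderOf T` since `χ` is injective
    have hinj : Function.Injective χ := (MonoidHom.ker_eq_bot_iff χ).1 hχ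
    have h1 : orderOf (χ g₀) = orderOf σ := by
      rw [orderOf_injective χ hinj g₀, hg₀, ← Subgroup.orderOf_coe]
    rw [← h1]
    exact IsPrimitiveRoot.coe_units_iff.2 (IsPrimitiveRoot.orderOf (χ g₀))
  · rw [Module.End.hasEigenvalue_iff]
    refine ne_bot_of_le_ne_bot hne ?_
    exact iInf_le (fun h : ↥(Subgroup.zpowers σ) ↦
      Module.End.eigenspace (oneFormRep M (h : autGroup M)) (χ h : ℂ)) g₀

end TwoLe

end RiemannSurface

end Literature.Geometry.Kaehler
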